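import Summits.ABC.ABC.Theorems.DefiniteXiDefiniteRTControlPrime
import Literature.NumberTheory.EllipticCurves.ManinConstantArbitraryParametrizationIntegralProofs
import Literature.NumberTheory.EllipticCurves.TakahashiDegreeFormulaFromDictionaryHolds
import Literature.NumberTheory.Automorphic.ShimuraCurveRibetTakahashiSemistableManinProofs
import Literature.NumberTheory.Automorphic.ShimuraCurveRibetTakahashiPairwiseEisensteinProofs
import Literature.NumberTheory.EllipticCurves.IsogenyConductorModularityProofs
import HarnessLib

/-!
# Stub ideation k2, GEN 5 (FAMILY 2 — RESHAPE) for `stub_takahashi : takahashi2001_thm_2_3_of_coprime`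
# (crux `DefiniteXi.DefiniteRTControlPrime`, stmt-ABC-11338) — companion of `STUB-IDEAS-stub_takahashi-2.md` (gen 5)

Kernel-checked content of the gen-5 memo (k2 gens 2–4 stand by reference: `StubIdeas2G{2,3,4}TakahashiSketch.lean`).

* §0 `definiteRTControlPrime_of_two_leaves` — CORRECTION of gen-4 §1: the crux ALREADY rests on two named
  facts {`takahashi2001_thm_2_3_of_coprime`, `mazurKenku_exists_cyclic_isogeny`} (Pasten's `163`-fact and
  Lemma 6.8 are tree theorems over Mazur–Kenku; the Edixhoven/Stevens input is `int_of_smul_periodLattice_le_all`).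
* §1 regime algebra `TakahashiCoprimeAt good` (the stub restricted to cofactors `M` with `good M`):
  `stub ↔ TakahashiCoprimeAt ⊤`, monotonicity, union, `stub ⟸ At Squarefree ∧ At ¬Squarefree`.
* §2 THE SQUAREFREE REGIME IS FREE: the seam "conductor-restricted minimality ⇒ minimality among all
  curves with the same newform" closes at square-free LEVEL by the tree theorem
  `IsNewformOf.level_eq_conductorNorm_of_squarefree_level` (Atkin–Lehner arithmetic, no Carayol), so
  `TakahashiCoprimeAt Squarefree ⟸ takahashi2001_thm_2_3 ⟸ takahashi2001_characterGroupDictionary`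
  (reviewed square-free dictionary def ALREADY IN THE TREE + the PROVED rank one
  `takahashi2001_brandtEigenLattice_rank_one_holds`). No new typing for semistable levels.
* §3 the special case the composition consumes: Frey cofactors `M ∣ 2⁸·R`, `R` squarefree
  (`isFreyCofactor_of_freyCurve`, proved) are squarefree or two-additive `M = 2^e M'`, `e ≥ 2`, `M'` odd
  squarefree (`squarefree_or_twoAdditive_of_isFreyCofactor`, proved); composition variant consuming the
  stub only at Frey cofactors (`definiteRTControlPrime_of_at_freyCofactor`, PROVED: clone of the landed
  `definiteRTControlPrime_of_facts` with its single Takahashi line changed).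
* §4 parametrised leaves `D1At good` (k1's D1 clauses) and `H1At good` (rank one) with
  `at_of_D1At_of_H1At : D1At good → H1At good → TakahashiCoprimeAt good` (proved), and the consolidated
  assemblies: `stub ⟸ {charGroupDict, D1At ¬Sqfree, H1At ¬Sqfree}` and
  `DefiniteRTControlPrime ⟸ {charGroupDict, D1At ¬Sqfree, H1At ¬Sqfree, Mazur–Kenku}` (sorry-free), resp.
  `⟸ {charGroupDict, D1At TwoAdditive, H1At TwoAdditive, Mazur–Kenku}` (through the §3 clone; sorry-free).
* §5 binder unification: under modularity (`nonempty_modularParametrizationData`) the conductor-restricted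
  binder equals the unrestricted one at EVERY level (`minimal_of_conductorMinimal_of_modularity`, proved).
-/

set_option linter.dupNamespace false

noncomputable section

namespace Summit.ABC.ABC.Cruxes.DefiniteRTControlPrime.StubIdeas2G5

open Summit.ABC.ABC.Theses.DefiniteXi
open Summit.ABC.ABC.Theorems.DefiniteRTControlPrime
open Literature.NumberTheory.EllipticCurves Literature.NumberTheory.EllipticCurves.ModularForms
open Literature.NumberTheory.Automorphic WeierstrassCurve
open scoped BigOperators

/-! ## §0 The crux on two leaves (correction of gen-4 §1) -/

/-- The crux from Takahashi 2.3 at `r ∥ N` and Mazur–Kenku ONLY (everything else is proved in the tree). -/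
theorem definiteRTControlPrime_of_two_leaves (hT : takahashi2001_thm_2_3_of_coprime)
    (hMK : mazurKenku_exists_cyclic_isogeny) : DefiniteRTControlPrime :=
  definiteRTControlPrime_of_mazurKenku_of_integrality hT hMK int_of_smul_periodLattice_le_all

/-! ## §1 Regime algebra -/

/-- The stub's statement restricted to cofactors `M` with `good M`. -/
def TakahashiCoprimeAt (good : ℕ → Prop) : Prop :=
  ∀ (W : WeierstrassCurve ℚ) [W.IsElliptic] (M r : ℕ) [NeZero (M * r)],
    good M → r.Prime → M.Coprime r → W.conductorNorm ℤ = M * r →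
    ∀ P : ModularParametrizationData W (M * r),
      (∀ (W' : WeierstrassCurve ℚ) [W'.IsElliptic], W'.conductorNorm ℤ = M * r →
          ∀ P' : ModularParametrizationData W' (M * r),
          P'.f = P.f → P.modularDegree ≤ P'.modularDegree) →
      ∀ S : Brandt.XiSetup M r,
        ∃ i j : ℕ, 0 < i ∧ i * j = (W.minimalDiscriminantNorm ℤ).factorization r ∧
          i ∣ S.xi (fun n => W.LFunction n) ∧
          P.modularDegree * i = S.xi (fun n => W.LFunction n) * j

theorem stub_iff_at_true : takahashi2001_thm_2_3_of_coprime ↔ TakahashiCoprimeAt fun _ => True := by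
  constructor
  · intro h W _ M r _ _ hr hcop hN P hmin S
    exact h W M r hr hcop hN P hmin S
  · intro h W _ M r _ hr hcop hN P hmin S
    exact h W M r trivial hr hcop hN P hmin S

theorem TakahashiCoprimeAt.mono {A B : ℕ → Prop} (hAB : ∀ M, A M → B M)
    (h : TakahashiCoprimeAt B) : TakahashiCoprimeAt A :=
  fun W _ M r _ hA hr hcop hN P hmin S => h W M r (hAB M hA) hr hcop hN P hmin S

theorem TakahashiCoprimeAt.union {A B : ℕ → Prop} (hA : TakahashiCoprimeAt A)
    (hB : TakahashiCoprimeAt B) : TakahashiCoprimeAt fun M => A M ∨ B M := by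
  intro W _ M r _ hM hr hcop hN P hmin S
  rcases hM with hM | hM
  · exact hA W M r hM hr hcop hN P hmin S
  · exact hB W M r hM hr hcop hN P hmin S

/-- RESHAPE R5-A: the stub is the conjunction of its squarefree and non-squarefree regimes. -/
theorem stub_of_at_squarefree_of_at_not (hA : TakahashiCoprimeAt Squarefree)
    (hB : TakahashiCoprimeAt fun M => ¬ Squarefree M) : takahashi2001_thm_2_3_of_coprime :=
  stub_iff_at_true.mpr ((hA.union hB).mono fun M _ => em (Squarefree M))

/-- The corollary shape consumed by the composition, for any regime. -/
theorem TakahashiCoprimeAt.modularDegree_le_brandtXi_mul {good : ℕ → Prop}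
    (h : TakahashiCoprimeAt good) (W : WeierstrassCurve ℚ) [W.IsElliptic] (M r : ℕ) [NeZero (M * r)]
    (hM : good M) (hr : r.Prime) (hcop : M.Coprime r) (hN : W.conductorNorm ℤ = M * r)
    (P : ModularParametrizationData W (M * r))
    (hmin : ∀ (W' : WeierstrassCurve ℚ) [W'.IsElliptic], W'.conductorNorm ℤ = M * r →
      ∀ P' : ModularParametrizationData W' (M * r),
        P'.f = P.f → P.modularDegree ≤ P'.modularDegree) :
    P.modularDegree ≤
      brandtXi M r (fun n => W.LFunction n) * (W.minimalDiscriminantNorm ℤ).factorization r := by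
  obtain ⟨S, hS⟩ := exists_brandtXi_eq (takahashi2001_thm_2_3_of_coprime.nonempty_xiSetup' hr hcop)
    (fun n => W.LFunction n)
  rw [hS]
  obtain ⟨i, j, hi, hij, -, hδ⟩ := h W M r hM hr hcop hN P hmin S
  calc P.modularDegree ≤ P.modularDegree * i := Nat.le_mul_of_pos_right _ hi
    _ = S.xi (fun n => W.LFunction n) * j := hδ
    _ ≤ S.xi (fun n => W.LFunction n) * (i * j) :=
        Nat.mul_le_mul_left _ (Nat.le_mul_of_pos_left _ hi)
    _ = _ := by rw [hij]

/-! ## §2 The squarefree regime is free -/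

/-- SEAM (proved, no Carayol): at a square-free LEVEL every parametrised curve has conductor = level
(`IsNewformOf.level_eq_conductorNorm_of_squarefree_level`), so conductor-restricted minimality is
minimality among all curves with the same newform. -/
theorem minimal_of_conductorMinimal_of_squarefree {W : WeierstrassCurve ℚ} [W.IsElliptic] {N : ℕ}
    [NeZero N] (hsq : Squarefree N) (P : ModularParametrizationData W N)
    (hmin : ∀ (W' : WeierstrassCurve ℚ) [W'.IsElliptic], W'.conductorNorm ℤ = N →
      ∀ P' : ModularParametrizationData W' N, P'.f = P.f → P.modularDegree ≤ P'.modularDegree)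
    (W' : WeierstrassCurve ℚ) [W'.IsElliptic] (P' : ModularParametrizationData W' N)
    (hP' : P'.f = P.f) : P.modularDegree ≤ P'.modularDegree :=
  hmin W' (P'.isNewformOf.level_eq_conductorNorm_of_squarefree_level hsq).symm P' hP'

/-- The squarefree regime of the stub from the tree's square-free named fact `takahashi2001_thm_2_3`. -/
theorem at_squarefree_of_thm_2_3 (h : takahashi2001_thm_2_3) : TakahashiCoprimeAt Squarefree := by
  intro W _ M r _ hM hr hcop hN P hmin S
  have hsq : Squarefree (M * r) := (Nat.squarefree_mul hcop).mpr ⟨hM, hr.squarefree⟩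
  exact h W M r hr hsq hN P (minimal_of_conductorMinimal_of_squarefree hsq P hmin) S

/-- … hence from the EXISTING reviewed dictionary def (rank one is a tree theorem at square-free level). -/
theorem at_squarefree_of_dictionary (hD : takahashi2001_characterGroupDictionary) :
    TakahashiCoprimeAt Squarefree :=
  at_squarefree_of_thm_2_3
    (takahashi2001_thm_2_3_holds_of takahashi2001_brandtEigenLattice_rank_one_holds hD)

/-- R5-A assembled: `stub ⟸ {existing square-free dictionary, non-squarefree regime}`. -/
theorem stub_of_dictionary_of_at_not (hD : takahashi2001_characterGroupDictionary)
    (hB : TakahashiCoprimeAt fun M => ¬ Squarefree M) : takahashi2001_thm_2_3_of_coprime :=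
  stub_of_at_squarefree_of_at_not (at_squarefree_of_dictionary hD) hB

/-! ## §3 The special case the composition consumes: Frey cofactors -/

/-- Cofactors `M = N/q` of Frey conductors: `M ∣ 2⁸ · R` with `R` squarefree. -/
def IsFreyCofactor (M : ℕ) : Prop := ∃ R : ℕ, Squarefree R ∧ M ∣ 2 ^ 8 * R

/-- The additive-at-`2` cofactors: `M = 2^e · M'`, `e ≥ 2`, `M'` odd squarefree. -/
def IsTwoAdditiveCofactor (M : ℕ) : Prop :=
  ∃ e M' : ℕ, 2 ≤ e ∧ Odd M' ∧ Squarefree M' ∧ M = 2 ^ e * M'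

/-- Every cofactor met by the composition is a Frey cofactor (`conductorNorm_freyCurve_dvd_holds`). -/
theorem isFreyCofactor_of_freyCurve (a b : ℤ) (hab : IsCoprime a b) (h0 : a * b * (a + b) ≠ 0)
    {M q : ℕ} (hN : (freyCurve a b).conductorNorm ℤ = M * q) : IsFreyCofactor M := by
  refine ⟨(UniqueFactorizationMonoid.radical (a * b * (a + b))).natAbs,
    Int.squarefree_natAbs.mpr UniqueFactorizationMonoid.squarefree_radical, ?_⟩
  have h := conductorNorm_freyCurve_dvd_holds a b hab h0
  rw [hN] at h
  exact (Dvd.intro q rfl).trans h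

/-- Elementary dichotomy: a nonzero Frey cofactor is squarefree or two-additive. -/
theorem squarefree_or_twoAdditive_of_isFreyCofactor {M : ℕ} (hM0 : M ≠ 0) (hM : IsFreyCofactor M) :
    Squarefree M ∨ IsTwoAdditiveCofactor M := by
  obtain ⟨R, hR, hdvd⟩ := hM
  by_cases hsq : Squarefree M
  · exact Or.inl hsq
  right
  obtain ⟨e, M', hodd, hM⟩ := Nat.exists_eq_two_pow_mul_odd hM0
  have hM'dvd : M' ∣ 2 ^ 8 * R := (Dvd.intro_left (2 ^ e) hM.symm).trans hdvd
  have hcop : Nat.Coprime M' (2 ^ 8) := Nat.Coprime.pow_right 8 (Nat.coprime_two_right.mpr hodd)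
  have hM'R : M' ∣ R := hcop.dvd_of_dvd_mul_left hM'dvd
  have hM'sq : Squarefree M' := hR.squarefree_of_dvd hM'R
  refine ⟨e, M', ?_, hodd, hM'sq, hM⟩
  by_contra he
  have he' : e < 2 := Nat.lt_of_not_le he
  interval_cases e
  · exact hsq (by simpa [hM] using hM'sq)
  · apply hsq
    rw [hM, pow_one]
    exact (Nat.squarefree_mul (Nat.coprime_two_left.mpr hodd)).mpr ⟨Nat.prime_two.squarefree, hM'sq⟩

/-- The Frey regime from the squarefree regime and the two-additive regime (proved). -/
theorem at_freyCofactor_of (hA : TakahashiCoprimeAt Squarefree)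
    (hB : TakahashiCoprimeAt IsTwoAdditiveCofactor) : TakahashiCoprimeAt IsFreyCofactor := by
  intro W _ M r _ hM hr hcop hN P hmin S
  have hM0 : M ≠ 0 := fun h => NeZero.ne (M * r) (by rw [h, zero_mul])
  rcases squarefree_or_twoAdditive_of_isFreyCofactor hM0 hM with h | h
  · exact hA W M r h hr hcop hN P hmin S
  · exact hB W M r h hr hcop hN P hmin S

/-- The full stub trivially gives the Frey regime. -/
theorem at_freyCofactor_of_stub (h : takahashi2001_thm_2_3_of_coprime) :
    TakahashiCoprimeAt IsFreyCofactor :=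
  (stub_iff_at_true.mp h).mono fun _ _ => trivial

/-- RESHAPE R5-B (PROVED): the composition consumes the stub only at Frey cofactors — verbatim clone of
the landed `definiteRTControlPrime_of_facts` (p97354) with its single Takahashi line replaced by
`hT.modularDegree_le_brandtXi_mul Ws M q (isFreyCofactor_of_freyCurve a b hab h0 hN) …`. -/
theorem definiteRTControlPrime_of_at_freyCofactor (hT : TakahashiCoprimeAt IsFreyCofactor)
    (h163 : PastenShimura2024_minimalDegree_le_163_mul) (h68 : PastenShimura2024_lemma_6_8) :
    DefiniteRTControlPrime := by
  intro ε hε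
  refine ⟨4 * 163 * 163, ?_⟩
  intro a b hab h0 N _ hN q hq hq2 hqN D hDmin
  -- `N = M q`
  obtain ⟨M, hM⟩ := hqN
  rw [mul_comm] at hM
  subst hM
  haveI := isElliptic_freyCurve h0
  have hdiv : M * q / q = M := Nat.mul_div_cancel M hq.pos
  rw [hdiv]
  have hqN' : q ∣ (freyCurve a b).conductorNorm ℤ := by rw [hN]; exact Dvd.intro_left M rfl
  -- `gcd(M, q) = 1`
  have hcop : M.Coprime q := by
    have h := stub_freyLocal a b hab h0 q hq hq2 hqN'
    rwa [hN, hdiv] at h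
  -- a global minimal model `W_m = C • E`, its data, a minimal one
  obtain ⟨C, hC⟩ := hasGlobalMinimalModel_rat_holds (freyCurve a b)
  haveI := hC
  have hNm : (C • freyCurve a b).conductorNorm ℤ = M * q := by rw [conductorNorm_smul_rat, hN]
  have hne : Nonempty (ModularParametrizationData (C • freyCurve a b) (M * q)) :=
    (Summit.ABC.ABC.Theorems.nonempty_modularParametrizationData_smul_iff C).mpr ⟨D⟩
  obtain ⟨D₁, -, hD₁min⟩ := exists_minimal_datum hne
  -- the lattice-optimal datum of the class of `f₁ := D₁.f`
  obtain ⟨W₀, hW₀, D₀, hf₀, h₀⟩ := D₁.exists_optimalDatum'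
  haveI := hW₀
  have hker₀ : D₀.isogenyMap.ker = ⊥ := D₀.isogenyMap_ker_eq_bot_iff.mpr h₀
  have hmin₀ : ∀ (W' : WeierstrassCurve ℚ) [W'.IsElliptic]
      (D' : ModularParametrizationData W' (M * q)), D'.f = D₀.f →
        D₀.modularDegree ≤ D'.modularDegree := fun W' _ D' hD' =>
    D₀.modularDegree_le_of_isogenyMap_ker_eq_bot hker₀ D' hD'
  -- (T_deg) `deg D₁ ≤ 163 · deg D₀`
  have h163' : D₁.modularDegree ≤ 163 * D₀.modularDegree :=
    h163 (M * q) W₀ (C • freyCurve a b) D₀ D₁ hf₀.symm hmin₀ hD₁min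
  -- the conductor-restricted optimal pivot `(W⋆, P⋆)`
  obtain ⟨Ws, hWs, Ps, hNs, hfs, hPsmin⟩ := exists_conductorMinimal D₁ hNm
  haveI := hWs
  have h0s : D₀.modularDegree ≤ Ps.modularDegree := hmin₀ Ws Ps (hfs.trans hf₀.symm)
  -- Takahashi at `(W⋆, P⋆)`
  have hTak : Ps.modularDegree ≤ brandtXi M q (fun n => Ws.LFunction n) *
      (Ws.minimalDiscriminantNorm ℤ).factorization q :=
    hT.modularDegree_le_brandtXi_mul Ws M q (isFreyCofactor_of_freyCurve a b hab h0 hN) hq hcop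
      hNs Ps hPsmin
  -- `a(W⋆) = a(f₁) = a(W_m) = a(E)`
  have hL : (fun n => Ws.LFunction n) = fun n => (freyCurve a b).LFunction n := by
    funext n
    have h1 := Ps.isNewformOf.2 n
    have h2 := D₁.isNewformOf.2 n
    rw [hfs] at h1
    rw [h1, LFunction_smul] at h2
    exact_mod_cast h2
  rw [hL] at hTak
  -- (T_val) along `E ~ W_m ~ W⋆`
  have hiso : (freyCurve a b).IsIsogenous Ws :=
    (isIsogenous_smul (freyCurve a b) C).trans' (isIsogenous_of_f_eq D₁ Ps hfs)
  have hval : (Ws.minimalDiscriminantNorm ℤ).factorization q ≤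
      163 * ((freyCurve a b).minimalDiscriminantNorm ℤ).factorization q :=
    stub_valTransport h68 a b hab h0 q hq hq2 hqN' Ws hiso
  -- (T_model) back to the Frey model
  obtain ⟨D₁', -, hdeg₁'⟩ := stub_smulTransportDeg C D₁
  have hscale : (C.u : ℚ).num.natAbs ≤ 2 := stub_freyScale a b hab h0 C hC
  have hD : D.deg ≤ 4 * D₁.modularDegree := by
    calc D.deg ≤ D₁'.deg := hDmin D₁'
      _ = (C.u : ℚ).num.natAbs ^ 2 * D₁.deg := hdeg₁'
      _ ≤ 2 ^ 2 * D₁.deg := Nat.mul_le_mul_right _ (Nat.pow_le_pow_left hscale 2)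
      _ = 4 * D₁.modularDegree := by norm_num [ModularParametrizationData.modularDegree]
  -- the chain in `ℕ`
  set ξ : ℕ := brandtXi M q (fun n => (freyCurve a b).LFunction n) with hξ
  set v : ℕ := ((freyCurve a b).minimalDiscriminantNorm ℤ).factorization q with hv
  have hchain : D.deg ≤ 4 * 163 * 163 * (ξ * v) :=
    calc D.deg ≤ 4 * D₁.modularDegree := hD
      _ ≤ 4 * (163 * D₀.modularDegree) := Nat.mul_le_mul_left _ h163'
      _ ≤ 4 * (163 * Ps.modularDegree) := Nat.mul_le_mul_left _ (Nat.mul_le_mul_left _ h0s)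
      _ ≤ 4 * (163 * (ξ * (Ws.minimalDiscriminantNorm ℤ).factorization q)) :=
          Nat.mul_le_mul_left _ (Nat.mul_le_mul_left _ hTak)
      _ ≤ 4 * (163 * (ξ * (163 * v))) :=
          Nat.mul_le_mul_left _ (Nat.mul_le_mul_left _ (Nat.mul_le_mul_left _ hval))
      _ = 4 * 163 * 163 * (ξ * v) := by ring
  -- to `ℝ`, inserting the idle `N^ε ≥ 1`
  have hN1 : (1 : ℝ) ≤ ((M * q : ℕ) : ℝ) := by
    exact_mod_cast Nat.one_le_iff_ne_zero.mpr (NeZero.ne (M * q))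
  have hrpow : (1 : ℝ) ≤ ((M * q : ℕ) : ℝ) ^ ε := Real.one_le_rpow hN1 hε.le
  have hcast : (D.deg : ℝ) ≤ (4 * 163 * 163 : ℝ) * ((ξ : ℝ) * (v : ℝ)) := by
    exact_mod_cast hchain
  have hξv : (0 : ℝ) ≤ (ξ : ℝ) * (v : ℝ) := by positivity
  calc (D.deg : ℝ) ≤ (4 * 163 * 163 : ℝ) * ((ξ : ℝ) * (v : ℝ)) := hcast
    _ = (4 * 163 * 163 : ℝ) * 1 * ((ξ : ℝ) * (v : ℝ)) := by ring
    _ ≤ (4 * 163 * 163 : ℝ) * ((M * q : ℕ) : ℝ) ^ ε * ((ξ : ℝ) * (v : ℝ)) := by gcongr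

/-! ## §4 Parametrised leaves and the consolidated assemblies -/

/-- k1's dictionary leaf D1 (= gen-6 `H2flat`, clauses verbatim) restricted to cofactors with `good M`. -/
def D1At (good : ℕ → Prop) : Prop :=
  ∀ (W : WeierstrassCurve ℚ) [W.IsElliptic] (M r : ℕ) [NeZero (M * r)],
    good M → r.Prime → M.Coprime r → W.conductorNorm ℤ = M * r →
    ∀ P : ModularParametrizationData W (M * r),
      (∀ (W' : WeierstrassCurve ℚ) [W'.IsElliptic], W'.conductorNorm ℤ = M * r →
          ∀ P' : ModularParametrizationData W' (M * r),
          P'.f = P.f → P.modularDegree ≤ P'.modularDegree) →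
      ∀ (S : Brandt.XiSetup M r) [Fintype (Brandt.ClassSet S.O)],
        ∃ (X : Submodule ℤ (Brandt.ClassSet S.O → ℤ)) (pb : ℤ →ₗ[ℤ] X) (pf : X →ₗ[ℤ] ℤ),
          (∀ (a : ℤ) (y : X),
              ∑ i, (Brandt.weight S.O i : ℤ) * (pb a : Brandt.ClassSet S.O → ℤ) i *
                  (y : Brandt.ClassSet S.O → ℤ) i =
                ((W.minimalDiscriminantNorm ℤ).factorization r : ℤ) * a * pf y) ∧
          (∀ a : ℤ, pf (pb a) = (P.modularDegree : ℤ) * a) ∧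
          Function.Surjective pf ∧
          (∀ (m : ℤ) (v : Brandt.ClassSet S.O → ℤ), m ≠ 0 → m • v ∈ X → v ∈ X) ∧
          (∀ v : Brandt.ClassSet S.O → ℤ, ∑ i, v i = 0 → v ∈ X) ∧
          (pb 1 : Brandt.ClassSet S.O → ℤ) ∈
            Brandt.eigenLattice (M * r) (Brandt.matrix S.O) (fun n => W.LFunction n)

/-- k1/k3's multiplicity-one leaf H1 restricted to cofactors with `good M`. -/
def H1At (good : ℕ → Prop) : Prop :=
  ∀ (W : WeierstrassCurve ℚ) [W.IsElliptic] (M r : ℕ) [NeZero (M * r)],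
    good M → r.Prime → M.Coprime r → W.conductorNorm ℤ = M * r →
    ∀ (_P : ModularParametrizationData W (M * r)) (S : Brandt.XiSetup M r)
      [Fintype (Brandt.ClassSet S.O)],
      Module.finrank ℤ
        (Brandt.eigenLattice (M * r) (Brandt.matrix S.O) (fun n => W.LFunction n)) = 1

/-- Leaves ⇒ regime (proved, via the tree's `exists_image_coker_eisenstein_of_brandtData`). -/
theorem at_of_D1At_of_H1At {good : ℕ → Prop} (hD : D1At good) (h1 : H1At good) :
    TakahashiCoprimeAt good := by
  intro W _ M r _ hM hr hcop hN P hmin S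
  classical
  letI : Fintype (Brandt.ClassSet S.O) := Fintype.ofFinite _
  obtain ⟨X, pb, pf, hadj, hδ, hsurj, hsat, hdeg, hmem⟩ := hD W M r hM hr hcop hN P hmin S
  obtain ⟨i, j, hi, hij, hiξ, hδi, -⟩ := exists_image_coker_eisenstein_of_brandtData W M r hr hN P S
    X pb pf hadj hδ hsurj hsat hdeg (h1 W M r hM hr hcop hN P S) hmem
  exact ⟨i, j, hi, hij, hiξ, hδi⟩

/-- H1 is a tree theorem on the squarefree regime (k1 G7.1, restated in regime form). -/
theorem h1At_squarefree : H1At Squarefree := by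
  intro W _ M r _ hM hr hcop hN P S _
  exact takahashi2001_brandtEigenLattice_rank_one_holds W M r hr
    ((Nat.squarefree_mul hcop).mpr ⟨hM, hr.squarefree⟩) hN P S

/-- CONSOLIDATED (sorry-free): the stub from the existing square-free dictionary plus the two NEW leaves
typed ONLY on non-squarefree cofactors. -/
theorem stub_of_consolidated (hD₀ : takahashi2001_characterGroupDictionary)
    (hD : D1At fun M => ¬ Squarefree M) (h1 : H1At fun M => ¬ Squarefree M) :
    takahashi2001_thm_2_3_of_coprime :=
  stub_of_dictionary_of_at_not hD₀ (at_of_D1At_of_H1At hD h1)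

/-- CONSOLIDATED (sorry-free): the crux from {square-free dictionary (in tree), D1 and H1 on
non-squarefree cofactors, Mazur–Kenku}. -/
theorem definiteRTControlPrime_of_consolidated (hD₀ : takahashi2001_characterGroupDictionary)
    (hD : D1At fun M => ¬ Squarefree M) (h1 : H1At fun M => ¬ Squarefree M)
    (hMK : mazurKenku_exists_cyclic_isogeny) : DefiniteRTControlPrime :=
  definiteRTControlPrime_of_two_leaves (stub_of_consolidated hD₀ hD h1) hMK

/-- CONSOLIDATED AT FREY COFACTORS (through the §3 clone): the crux from {square-free dictionary,
D1 and H1 on the additive-at-2 cofactors `2^e M'` only, Mazur–Kenku}. -/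
theorem definiteRTControlPrime_of_consolidated_frey (hD₀ : takahashi2001_characterGroupDictionary)
    (hD : D1At IsTwoAdditiveCofactor) (h1 : H1At IsTwoAdditiveCofactor)
    (hMK : mazurKenku_exists_cyclic_isogeny) : DefiniteRTControlPrime :=
  definiteRTControlPrime_of_at_freyCofactor
    (at_freyCofactor_of (at_squarefree_of_dictionary hD₀) (at_of_D1At_of_H1At hD h1))
    (PastenShimura2024_minimalDegree_le_163_mul_of_mazurKenku' hMK)
    (PastenShimura2024_lemma_6_8_of_mazurKenku' hMK)

/-! ## §5 Binder unification under modularity -/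

/-- Under modularity of all elliptic curves over `ℚ` (`nonempty_modularParametrizationData`, BCDT) the
conductor is an isogeny invariant (`conductorNorm_eq_of_isIsogenous_of_modularity`) and curves sharing a
newform are isogenous (`isIsogenous_of_f_eq`), so the conductor-restricted binder of the stub / D1 equals
the unrestricted binder of `takahashi2001_thm_2_3` / `takahashi2001_characterGroupDictionary` at EVERY level. -/
theorem minimal_of_conductorMinimal_of_modularity (hmod : nonempty_modularParametrizationData)
    {W : WeierstrassCurve ℚ} [W.IsElliptic] {N : ℕ} [NeZero N] (hW : W.conductorNorm ℤ = N)
    (P : ModularParametrizationData W N)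
    (hmin : ∀ (W' : WeierstrassCurve ℚ) [W'.IsElliptic], W'.conductorNorm ℤ = N →
      ∀ P' : ModularParametrizationData W' N, P'.f = P.f → P.modularDegree ≤ P'.modularDegree)
    (W' : WeierstrassCurve ℚ) [W'.IsElliptic] (P' : ModularParametrizationData W' N)
    (hP' : P'.f = P.f) : P.modularDegree ≤ P'.modularDegree :=
  hmin W' ((conductorNorm_eq_of_isIsogenous_of_modularity hmod W W'
    (isIsogenous_of_f_eq P P' hP')).symm.trans hW) P' hP'

end Summit.ABC.ABC.Cruxes.DefiniteRTControlPrime.StubIdeas2G5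

end
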